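import Summits.QuantumFields.YangMills.Theorems.UnitScaleTiltProp7TentInterpolation
import Literature.MathematicalPhysics.QuantumFieldTheory.Balaban1983to89.T3ContinuumYM3Torus
import HarnessLib

/-!
# N4 ∘ N3 GLUE and the T³ INSTANCE of the tent ∕ box-filter interpolation (route R, stub (P) linear flat core; CARD-19200-V3-g11 §2)

Cell ym3-torus, seat ym-ust-20520-w3 g2, `--supports stmt-QuantumFields-19200 --as helper`.  YM₃ on T³ is a RUNG (R3), not the Clay problem.

WHAT IS PROVED (sorry-free, no definition):
* ★ `sum_grad_sq_le_coarse_of_dirichlet` — DIRICHLET PRINCIPLE ⇒ COARSE BOUND: if `λ` has the least Dirichlet energy among the site functions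
  agreeing with it on the `k`-centres `Set.range (embIter k)` (the last conjunct of `Prop7PinnedHodgeSplit.exists_hodgeSplit_pinned` with
  `C := Set.range (embIter k)`, N3), then `Σ_b (grad c λ)(b)² ≤ ((L:ℝ)^k)^(d−2) · Σ_{c' : PBond P k} (grad c (λ ∘ embIter k))(c')²`
  (test the minimality against the interpolant of N4 `Prop7TentInterpolation.exists_tentInterpolant_grad`).
* ★ `sum_grad_sq_le_coarse_of_dirichlet_T3` — the same on run `K` of a T³ family (`P := F.P K`, `k := K − n`, `d = 3`): constant `(F.L:ℝ)^(K−n) = ℓ`,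
  the standing range `K − n ≤ m + K` discharged; and `exists_tentInterpolant_grad_T3` (the interpolant itself at `d = 3`).
-/

set_option autoImplicit false

noncomputable section

open scoped BigOperators

namespace Summit.QuantumFields.YangMills.Theorems.Prop7TentInterpolationT3

open Literature.MathematicalPhysics.QuantumFieldTheory.Balaban1983to89
open B15DeterminingSets (embIter)
open LatticeFieldCalculus (grad)
open T3ContinuumYM3Torus (T3Family)
open Prop7TentInterpolation (exists_tentInterpolant_grad)

variable {P : Params}

/-- **DIRICHLET ⇒ COARSE BOUND**: a site function of least Dirichlet energy among those agreeing with it on the `k`-centres has energy at most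
`(L^k)^{d−2}` times the energy of its restriction to the `k`-th lattice (N3's minimality tested against N4's box-filter interpolant).
[cite: Balaban1985Variational, Prop. 7 p.299, (141)-(143) p.299] -/
theorem sum_grad_sq_le_coarse_of_dirichlet (c : ℝ) {k : ℕ} (hk : k ≤ P.m + P.K) (lam : Site P 0 → ℝ)
    (hmin : ∀ ψ : Site P 0 → ℝ, (∀ x ∈ Set.range (embIter k), ψ x = lam x) →
      ∑ b : PBond P 0, grad c lam b ^ 2 ≤ ∑ b : PBond P 0, grad c ψ b ^ 2) :
    ∑ b : PBond P 0, grad c lam b ^ 2 ≤ ((P.L : ℝ) ^ k) ^ (P.d - 2) * ∑ b : PBond P k, grad c (fun y => lam (embIter k y)) b ^ 2 := by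
  obtain ⟨ψ, h1, h2⟩ := exists_tentInterpolant_grad k hk c (fun y => lam (embIter k y))
  refine (hmin ψ ?_).trans h2
  rintro x ⟨y, rfl⟩
  exact h1 y

/-- The same with the centres given as any set `C ⊆ Set.range (embIter k)` containing the support of the constraint (monotonicity of the test class).
[cite: Balaban1985Variational, Prop. 7 p.299, (141)-(143) p.299] -/
theorem sum_grad_sq_le_coarse_of_dirichlet_of_subset (c : ℝ) {k : ℕ} (hk : k ≤ P.m + P.K) (lam : Site P 0 → ℝ) {C : Set (Site P 0)}
    (hC : C ⊆ Set.range (embIter k))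
    (hmin : ∀ ψ : Site P 0 → ℝ, (∀ x ∈ C, ψ x = lam x) → ∑ b : PBond P 0, grad c lam b ^ 2 ≤ ∑ b : PBond P 0, grad c ψ b ^ 2) :
    ∑ b : PBond P 0, grad c lam b ^ 2 ≤ ((P.L : ℝ) ^ k) ^ (P.d - 2) * ∑ b : PBond P k, grad c (fun y => lam (embIter k y)) b ^ 2 :=
  sum_grad_sq_le_coarse_of_dirichlet c hk lam fun ψ hψ => hmin ψ fun x hx => hψ x (hC hx)

/-- **T³ INSTANCE of N4**: on run `K` of a T³ family, data on the `(K−n)`-th lattice extend to the finest torus through the centres with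
`Σ_b (grad c ψ)(b)² ≤ L^{K−n} · Σ_{c'} (grad c f)(c')²` (`d = 3`: `ℓ^{d−2} = ℓ = L^{K−n}`). [cite: Balaban1985Variational, Prop. 7 p.299, (141)-(143) p.299] -/
theorem exists_tentInterpolant_grad_T3 (F : T3Family) (K n : ℕ) (c : ℝ) (f : Site (F.P K) (K - n) → ℝ) :
    ∃ ψ : Site (F.P K) 0 → ℝ, (∀ y : Site (F.P K) (K - n), ψ (embIter (K - n) y) = f y) ∧
      ∑ b : PBond (F.P K) 0, grad c ψ b ^ 2 ≤ (F.L : ℝ) ^ (K - n) * ∑ b : PBond (F.P K) (K - n), grad c f b ^ 2 := by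
  have hk : K - n ≤ (F.P K).m + (F.P K).K := by
    have := F.hm
    show K - n ≤ F.m + K
    omega
  obtain ⟨ψ, h1, h2⟩ := exists_tentInterpolant_grad (P := F.P K) (K - n) hk c f
  refine ⟨ψ, h1, ?_⟩
  simpa [T3Family.P_d] using h2

/-- **T³ INSTANCE of DIRICHLET ⇒ COARSE BOUND**: `Σ_b (grad c λ)(b)² ≤ L^{K−n} · Σ_{c'} (grad c (λ ∘ embIter (K−n)))(c')²` for every `λ` of least
energy among the site functions agreeing with it on the `(K−n)`-centres of run `K`. [cite: Balaban1985Variational, Prop. 7 p.299, (141)-(143) p.299] -/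
theorem sum_grad_sq_le_coarse_of_dirichlet_T3 (F : T3Family) (K n : ℕ) (c : ℝ) (lam : Site (F.P K) 0 → ℝ)
    (hmin : ∀ ψ : Site (F.P K) 0 → ℝ, (∀ x ∈ Set.range (embIter (K - n)), ψ x = lam x) →
      ∑ b : PBond (F.P K) 0, grad c lam b ^ 2 ≤ ∑ b : PBond (F.P K) 0, grad c ψ b ^ 2) :
    ∑ b : PBond (F.P K) 0, grad c lam b ^ 2
      ≤ (F.L : ℝ) ^ (K - n) * ∑ b : PBond (F.P K) (K - n), grad c (fun y => lam (embIter (K - n) y)) b ^ 2 := by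
  have hk : K - n ≤ (F.P K).m + (F.P K).K := by
    have := F.hm
    show K - n ≤ F.m + K
    omega
  have h := sum_grad_sq_le_coarse_of_dirichlet (P := F.P K) c hk lam hmin
  simpa [T3Family.P_d] using h

end Summit.QuantumFields.YangMills.Theorems.Prop7TentInterpolationT3

end
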